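import Mathlib.Algebra.Polynomial.Roots
import Mathlib.Algebra.Polynomial.Splits
import Mathlib.RingTheory.Valuation.Basic
import Mathlib.Tactic.LinearCombination
import Mathlib.Tactic.FieldSimp
import Mathlib.Tactic.ComputeDegree
import Mathlib.Data.Set.Card
import HarnessLib

/-!
# The critical locus of `t` on the curve `D_e : r^e = x(1 − x)` (GenEllTwo, support piece)

Support for `Summit.ABC.ABC.Theses.IUTThetaPilot.GenEllTwo` = [GenEll] Thm. 2.1 (ii) ⇒ (i) for
`(ℙ¹, [0]+[1]+[∞])` (S. Mochizuki, *Arithmetic elliptic curves in general position*, Math. J.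
Okayama Univ. 52 (2010), Thm. 2.1 p. 11; proof pp. 12–13 [cite: MochizukiGenEll2010]), in the
number-field-only architecture of the abc-iut cell (abc-iut-S6, `GENELLTWO-P1ROUTE.md` §2–§3):
the printed Galois cover `Y → ℙ¹` ramified with index `e` over the three cusps (p. 12) is realised
as the curve `D_e : r^e = x(1 − x)`, `e = 2k + 1`, and the printed noncritical Belyi map as
`φ = β ∘ t` with `t = 1/r + r^{(e+1)/2}/s = (s + r^{k+2})/(r·s)`, `s = 1 − 2x`. The bookkeeping of
§3 (d) of that note ("sharp Prop. 1.6" for the reduced divisor `E_φ`) needs the RAMIFICATION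
DIVISOR `R_t` of `t` in closed form. Writing `N := r²s³·dt/dr = −s³ + α(r)`,
`α(r) = (k+1)r^{k+2} − 2r^{3k+3}`, for the function cutting out `R_t` on the affine curve, this
file proves, over any field in which `2 ≠ 0` and `2k + 1 ≠ 0`:

* `zeroSet_eq` — **the zeros of `N` on `D_e` are exactly the points
  `Q_θ = ((1 − α(θ)/β(θ))/2, θ)`, `θ` a root of the explicit polynomial
  `R := α² − β³ ∈ ℤ[X]`** (`β(r) = 1 − 4r^{2k+1} = s²` on the curve), of degree `6k + 6 = 3e + 3`
  (`= deg R_t = 2g − 2 + 2·deg t`) and leading coefficient `4` (`natDegree_Rpoly`,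
  `leadingCoeff_Rpoly`); hence the zero set is finite of size `≤ 3e + 3` (`zeroSet_finite`,
  `zeroSet_ncard_le`) and permuted by field homomorphisms (`map_critX`, `aeval_Rpoly_map`) — so the
  set of critical values `A := t(R_t)` is finite and Galois-stable;
* `tDen_critPoint_ne_zero` — the zeros of `N` avoid the poles `r·s = 0` of `t`.

The companion file `GenEllDeCriticalLocusReduction.lean` proves the good-prime reduction
statement (a prime dividing `N(P)` is a prime at which `P` is congruent to a ramification point,
hence at which `t(P)` meets `A`). Everything is explicit polynomial algebra; no heights, no named
facts. Nothing here bears on the disputed parts of the abc-iut corpus ([GenEll] is refereed and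
granted by all sides).
-/

noncomputable section

open Polynomial

namespace Literature.NumberTheory.DiophantineGeometry.GenEll

namespace DeCrit

section Algebra

variable {K : Type*} [CommRing K]

/-- `α(r) := (k+1)·r^{k+2} − 2·r^{3k+3}` (`= ((e+1)/2)·r^{(e+3)/2} − 2·r^{(3e+3)/2}`, `e = 2k+1`):
the `s`-free part of the ramification function `N = r²s³·dt/dr = −s³ + α(r)` of
`t = 1/r + r^{(e+1)/2}/s` on `D_e`. [cite: MochizukiGenEll2010, Thm 2.1 proof p.12] -/
def alpha (k : ℕ) (r : K) : K := ((k : K) + 1) * r ^ (k + 2) - 2 * r ^ (3 * k + 3)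

/-- `β(r) := 1 − 4·r^{2k+1}`; on `D_e` one has `β(r) = (1 − 2x)² = s²`.
[cite: MochizukiGenEll2010, Thm 2.1 proof p.12] -/
def beta (k : ℕ) (r : K) : K := 1 - 4 * r ^ (2 * k + 1)

/-- The ramification function `N(x, r) := −s³ + α(r)`, `s = 1 − 2x`, of `t` on `D_e` in the
coordinates `z = (x, r)` (`N = r²s³·dt/dr`; its zeros on the affine curve are exactly the
ramification points of `t`). [cite: MochizukiGenEll2010, Thm 2.1 proof p.12] -/
def Nval (k : ℕ) (z : K × K) : K := -(1 - 2 * z.1) ^ 3 + alpha k z.2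

/-- The one-variable polynomial `R := α² − β³ ∈ ℤ[X]`, written out:
`R = 4X^{6k+6} + 64X^{6k+3} − 4(k+1)X^{4k+5} − 48X^{4k+2} + (k+1)²X^{2k+4} + 12X^{2k+1} − 1`;
its roots are the `r`-coordinates of the zeros of `N` on `D_e` (`deg R = 6k+6 = 3e+3 = deg R_t`,
the degree of the ramification divisor of `t`). [cite: MochizukiGenEll2010, Thm 2.1 proof p.12] -/
def Rpoly (k : ℕ) : ℤ[X] :=
  C 4 * X ^ (6 * k + 6) + C 64 * X ^ (6 * k + 3) - C (4 * ((k : ℤ) + 1)) * X ^ (4 * k + 5)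
    - C 48 * X ^ (4 * k + 2) + C (((k : ℤ) + 1) ^ 2) * X ^ (2 * k + 4) + C 12 * X ^ (2 * k + 1) - 1

/-- Evaluation of `R`: `R(r) = α(r)² − β(r)³`. [cite: MochizukiGenEll2010, Thm 2.1 proof p.12] -/
theorem aeval_Rpoly [Algebra ℤ K] (k : ℕ) (r : K) :
    aeval r (Rpoly k) = alpha k r ^ 2 - beta k r ^ 3 := by
  simp [Rpoly, alpha, beta, map_ofNat, map_natCast]
  ring

/-- `R(0) = −1`. [cite: MochizukiGenEll2010, Thm 2.1 proof p.12] -/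
theorem eval_zero_Rpoly (k : ℕ) : (Rpoly k).eval 0 = -1 := by
  simp [Rpoly]

/-- `deg R ≤ 6k + 6`. [cite: MochizukiGenEll2010, Thm 2.1 proof p.12] -/
theorem natDegree_Rpoly_le (k : ℕ) : (Rpoly k).natDegree ≤ 6 * k + 6 := by
  unfold Rpoly
  (compute_degree!; omega)

/-- The coefficient of `X^{6k+6}` in `R` is `4`. [cite: MochizukiGenEll2010, Thm 2.1 proof p.12] -/
theorem coeff_Rpoly_top (k : ℕ) : (Rpoly k).coeff (6 * k + 6) = 4 := by
  have h1 : 6 * k + 6 ≠ 6 * k + 3 := by omega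
  have h2 : 6 * k + 6 ≠ 4 * k + 5 := by omega
  have h3 : 6 * k + 6 ≠ 4 * k + 2 := by omega
  have h4 : 6 * k + 6 ≠ 2 * k + 4 := by omega
  have h5 : 6 * k + 6 ≠ 2 * k + 1 := by omega
  have h6 : 6 * k + 6 ≠ 0 := by omega
  rw [Rpoly]
  simp only [coeff_add, coeff_sub, coeff_C_mul, coeff_X_pow, coeff_one, if_true, if_neg h1,
    if_neg h2, if_neg h3, if_neg h4, if_neg h5, if_neg h6]
  norm_num

/-- `deg R = 6k + 6` (`= 3e + 3`). [cite: MochizukiGenEll2010, Thm 2.1 proof p.12] -/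
theorem natDegree_Rpoly (k : ℕ) : (Rpoly k).natDegree = 6 * k + 6 :=
  natDegree_eq_of_le_of_coeff_ne_zero (natDegree_Rpoly_le k) (by rw [coeff_Rpoly_top]; norm_num)

/-- The leading coefficient of `R` is `4`. [cite: MochizukiGenEll2010, Thm 2.1 proof p.12] -/
theorem leadingCoeff_Rpoly (k : ℕ) : (Rpoly k).leadingCoeff = 4 := by
  rw [leadingCoeff, natDegree_Rpoly, coeff_Rpoly_top]

/-- `R ≠ 0`. [cite: MochizukiGenEll2010, Thm 2.1 proof p.12] -/
theorem Rpoly_ne_zero (k : ℕ) : Rpoly k ≠ 0 := fun h => by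
  have := eval_zero_Rpoly k
  rw [h, eval_zero] at this
  norm_num at this

end Algebra

section Field

variable {K : Type*} [Field K]

/-- On `D_e` the ramification function is `N = −s·β(r) + α(r)` (`s = 1 − 2x`, `s² = β(r)`).
[cite: MochizukiGenEll2010, Thm 2.1 proof p.12] -/
theorem Nval_eq_of_mem (k : ℕ) {x r : K} (h : r ^ (2 * k + 1) = x * (1 - x)) :
    Nval k (x, r) = -((1 - 2 * x) * beta k r) + alpha k r := by
  simp only [Nval, beta]
  linear_combination (-4 * (1 - 2 * x)) * h

/-- On `D_e`, `β(r) = s²`. [cite: MochizukiGenEll2010, Thm 2.1 proof p.12] -/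
theorem beta_eq_sq_of_mem (k : ℕ) {x r : K} (h : r ^ (2 * k + 1) = x * (1 - x)) :
    beta k r = (1 - 2 * x) ^ 2 := by
  simp only [beta]
  linear_combination (-4 : K) * h

/-- A zero of `N` on `D_e` has `r`-coordinate a root of `R = α² − β³`. [cite: MochizukiGenEll2010, Thm 2.1 proof p.12] -/
theorem aeval_Rpoly_eq_zero_of_Nval_eq_zero (k : ℕ) {x r : K}
    (h : r ^ (2 * k + 1) = x * (1 - x)) (hN : Nval k (x, r) = 0) :
    aeval r (Rpoly k) = 0 := by
  rw [aeval_Rpoly]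
  rw [Nval_eq_of_mem k h] at hN
  have hb := beta_eq_sq_of_mem k h
  linear_combination (alpha k r + (1 - 2 * x) * beta k r) * hN - (beta k r) ^ 2 * hb


/-- A root `θ` of `R` is nonzero (`R(0) = −1`). [cite: MochizukiGenEll2010, Thm 2.1 proof p.12] -/
theorem root_ne_zero (k : ℕ) {θ : K} (hR : aeval θ (Rpoly k) = 0) : θ ≠ 0 := by
  rintro rfl
  rw [aeval_Rpoly] at hR
  simp [alpha, beta] at hR

/-- Over a field `K`, `R ∈ ℤ[X]` maps to a nonzero polynomial. [cite: MochizukiGenEll2010, Thm 2.1 proof p.12] -/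
theorem Rpoly_map_ne_zero (k : ℕ) : (Rpoly k).map (algebraMap ℤ K) ≠ 0 := fun h => by
  have h0 := congrArg (fun p : K[X] => p.eval 0) h
  simp only [eval_map, eval₂_at_zero, coeff_zero_eq_eval_zero, eval_zero_Rpoly, map_neg, map_one,
    eval_zero] at h0
  exact one_ne_zero (neg_eq_zero.mp h0)

/-- At a root `θ` of `R`, `β(θ) ≠ 0` provided `e = 2k+1 ≠ 0` in `K` (so the zeros of `N` stay
away from the Weierstrass points `s = 0`). [cite: MochizukiGenEll2010, Thm 2.1 proof p.12] -/
theorem beta_ne_zero_of_root (k : ℕ) (he : ((2 * k + 1 : ℕ) : K) ≠ 0) {θ : K}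
    (hR : aeval θ (Rpoly k) = 0) : beta k θ ≠ 0 := by
  intro hb
  have hθ : θ ≠ 0 := by
    rintro rfl
    simp [beta] at hb
  rw [aeval_Rpoly, hb] at hR
  have ha : alpha k θ = 0 := by simpa using hR
  have h2a : (2 : K) * alpha k θ = ((2 * k + 1 : ℕ) : K) * θ ^ (k + 2) := by
    simp only [alpha, beta] at hb ⊢
    push_cast
    linear_combination θ ^ (k + 2) * hb
  rw [ha, mul_zero] at h2a
  exact mul_ne_zero he (pow_ne_zero _ hθ) h2a.symm

/-- At a root `θ` of `R`, `α(θ) ≠ 0`. [cite: MochizukiGenEll2010, Thm 2.1 proof p.12] -/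
theorem alpha_ne_zero_of_root (k : ℕ) (he : ((2 * k + 1 : ℕ) : K) ≠ 0) {θ : K}
    (hR : aeval θ (Rpoly k) = 0) : alpha k θ ≠ 0 := by
  intro ha
  have hb := beta_ne_zero_of_root k he hR
  rw [aeval_Rpoly, ha] at hR
  have : beta k θ ^ 3 = 0 := by simpa using hR
  exact hb (pow_eq_zero_iff (by norm_num) |>.mp this)

/-- `s`-coordinate `s_θ := α(θ)/β(θ)` of the zero of `N` above a root `θ` of `R`. [cite: MochizukiGenEll2010, Thm 2.1 proof p.12] -/
def critS (k : ℕ) (θ : K) : K := alpha k θ / beta k θ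

/-- `x`-coordinate `x_θ := (1 − s_θ)/2` of the zero of `N` above a root `θ` of `R`. [cite: MochizukiGenEll2010, Thm 2.1 proof p.12] -/
def critX (k : ℕ) (θ : K) : K := (1 - critS k θ) / 2

/-- The zero `Q_θ := (x_θ, θ)` of `N` on `D_e` above a root `θ` of `R` (a ramification point of
`t`). [cite: MochizukiGenEll2010, Thm 2.1 proof p.12] -/
def critPoint (k : ℕ) (θ : K) : K × K := (critX k θ, θ)

/-- First coordinate of `Q_θ`. [cite: MochizukiGenEll2010, Thm 2.1 proof p.12] -/
@[simp] theorem critPoint_fst (k : ℕ) (θ : K) : (critPoint k θ).1 = critX k θ := rfl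

/-- Second coordinate of `Q_θ`. [cite: MochizukiGenEll2010, Thm 2.1 proof p.12] -/
@[simp] theorem critPoint_snd (k : ℕ) (θ : K) : (critPoint k θ).2 = θ := rfl

/-- `1 − 2x_θ = s_θ`. [cite: MochizukiGenEll2010, Thm 2.1 proof p.12] -/
theorem one_sub_two_mul_critX (k : ℕ) (h2 : (2 : K) ≠ 0) (θ : K) :
    1 - 2 * critX k θ = critS k θ := by
  unfold critX
  field_simp
  ring

/-- `s_θ² = β(θ)` at a root of `R`. [cite: MochizukiGenEll2010, Thm 2.1 proof p.12] -/
theorem critS_sq (k : ℕ) (he : ((2 * k + 1 : ℕ) : K) ≠ 0) {θ : K} (hR : aeval θ (Rpoly k) = 0) :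
    critS k θ ^ 2 = beta k θ := by
  have hb := beta_ne_zero_of_root k he hR
  rw [aeval_Rpoly] at hR
  unfold critS
  rw [div_pow, div_eq_iff (pow_ne_zero 2 hb)]
  linear_combination hR

/-- The point `Q_θ` lies on `D_e`: `θ^{2k+1} = x_θ(1 − x_θ)`. [cite: MochizukiGenEll2010, Thm 2.1 proof p.12] -/
theorem critPoint_mem (k : ℕ) (h2 : (2 : K) ≠ 0) (he : ((2 * k + 1 : ℕ) : K) ≠ 0) {θ : K}
    (hR : aeval θ (Rpoly k) = 0) : θ ^ (2 * k + 1) = critX k θ * (1 - critX k θ) := by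
  have h4 : (4 : K) ≠ 0 := by
    have := mul_ne_zero h2 h2
    norm_num at this
    exact this
  have hc := critS_sq k he hR
  have hx : critX k θ * (1 - critX k θ) = (1 - critS k θ ^ 2) / 4 := by
    unfold critX
    field_simp
    ring
  rw [hx, hc, beta]
  field_simp
  ring

/-- `N(Q_θ) = 0`. [cite: MochizukiGenEll2010, Thm 2.1 proof p.12] -/
theorem Nval_critPoint (k : ℕ) (h2 : (2 : K) ≠ 0) (he : ((2 * k + 1 : ℕ) : K) ≠ 0) {θ : K}
    (hR : aeval θ (Rpoly k) = 0) : Nval k (critPoint k θ) = 0 := by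
  have hb := beta_ne_zero_of_root k he hR
  rw [aeval_Rpoly] at hR
  rw [Nval, critPoint_fst, critPoint_snd, one_sub_two_mul_critX k h2, critS]
  field_simp
  linear_combination (-alpha k θ) * hR

/-- Uniqueness: a zero `(x, r)` of `N` on `D_e` is the point `Q_r`. [cite: MochizukiGenEll2010, Thm 2.1 proof p.12] -/
theorem fst_eq_critX_of_Nval_eq_zero (k : ℕ) (h2 : (2 : K) ≠ 0) (he : ((2 * k + 1 : ℕ) : K) ≠ 0)
    {x r : K} (h : r ^ (2 * k + 1) = x * (1 - x)) (hN : Nval k (x, r) = 0) : x = critX k r := by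
  have hR := aeval_Rpoly_eq_zero_of_Nval_eq_zero k h hN
  have hb := beta_ne_zero_of_root k he hR
  rw [Nval_eq_of_mem k h] at hN
  have hs : 1 - 2 * x = critS k r := by
    rw [critS, eq_div_iff hb]
    linear_combination -hN
  unfold critX
  rw [← hs]
  field_simp
  ring

/-- **The zero set of `N` on `D_e`** is the image of the root set of `R` under `θ ↦ Q_θ`
(over any field with `2 ≠ 0`, `2k+1 ≠ 0`). [cite: MochizukiGenEll2010, Thm 2.1 proof p.12] -/
theorem zeroSet_eq (k : ℕ) (h2 : (2 : K) ≠ 0) (he : ((2 * k + 1 : ℕ) : K) ≠ 0) :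
    {z : K × K | z.2 ^ (2 * k + 1) = z.1 * (1 - z.1) ∧ Nval k z = 0} =
      critPoint k '' ((Rpoly k).rootSet K) := by
  ext ⟨x, r⟩
  simp only [Set.mem_setOf_eq, Set.mem_image, mem_rootSet']
  constructor
  · rintro ⟨h, hN⟩
    refine ⟨r, ⟨Rpoly_map_ne_zero k, aeval_Rpoly_eq_zero_of_Nval_eq_zero k h hN⟩, ?_⟩
    rw [critPoint, fst_eq_critX_of_Nval_eq_zero k h2 he h hN]
  · rintro ⟨θ, ⟨_, hR⟩, hθ⟩
    simp only [critPoint, Prod.mk.injEq] at hθ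
    obtain ⟨rfl, rfl⟩ := hθ
    exact ⟨critPoint_mem k h2 he hR, Nval_critPoint k h2 he hR⟩

/-- The zero set of `N` on `D_e` is finite. [cite: MochizukiGenEll2010, Thm 2.1 proof p.12] -/
theorem zeroSet_finite (k : ℕ) (h2 : (2 : K) ≠ 0) (he : ((2 * k + 1 : ℕ) : K) ≠ 0) :
    {z : K × K | z.2 ^ (2 * k + 1) = z.1 * (1 - z.1) ∧ Nval k z = 0}.Finite := by
  rw [zeroSet_eq k h2 he]
  exact ((Rpoly k).rootSet_finite K).image _

/-- The number of roots of `R` in a field is at most `6k + 6 = 3e + 3`. [cite: MochizukiGenEll2010, Thm 2.1 proof p.12] -/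
theorem ncard_rootSet_le (k : ℕ) : ((Rpoly k).rootSet K).ncard ≤ 6 * k + 6 := by
  classical
  rw [rootSet_def, Set.ncard_coe_finset]
  refine (Multiset.toFinset_card_le _).trans ?_
  refine (card_roots' _).trans ?_
  exact (natDegree_map_le).trans (natDegree_Rpoly_le k)

/-- `N` has at most `6k + 6 = 3e + 3` zeros on `D_e` (`= deg R_t`). [cite: MochizukiGenEll2010, Thm 2.1 proof p.12] -/
theorem zeroSet_ncard_le (k : ℕ) (h2 : (2 : K) ≠ 0) (he : ((2 * k + 1 : ℕ) : K) ≠ 0) :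
    {z : K × K | z.2 ^ (2 * k + 1) = z.1 * (1 - z.1) ∧ Nval k z = 0}.ncard ≤ 6 * k + 6 := by
  rw [zeroSet_eq k h2 he]
  exact (Set.ncard_image_le ((Rpoly k).rootSet_finite K)).trans (ncard_rootSet_le k)

/-- The zeros of `N` avoid the poles of `t`: at `Q_θ`, `r = θ ≠ 0` and `s = 1 − 2x_θ ≠ 0`, so the
denominator `r·s` of `t` does not vanish. [cite: MochizukiGenEll2010, Thm 2.1 proof p.12] -/
theorem tDen_critPoint_ne_zero (k : ℕ) (h2 : (2 : K) ≠ 0) (he : ((2 * k + 1 : ℕ) : K) ≠ 0)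
    {θ : K} (hR : aeval θ (Rpoly k) = 0) : θ * (1 - 2 * critX k θ) ≠ 0 := by
  rw [one_sub_two_mul_critX k h2]
  exact mul_ne_zero (root_ne_zero k hR)
    (div_ne_zero (alpha_ne_zero_of_root k he hR) (beta_ne_zero_of_root k he hR))

section Map

variable {L : Type*} [Field L] (f : K →+* L)

/-- `α` commutes with ring homomorphisms. [cite: MochizukiGenEll2010, Thm 2.1 proof p.12] -/
theorem map_alpha (k : ℕ) (r : K) : f (alpha k r) = alpha k (f r) := by
  simp [alpha, map_ofNat, map_natCast]

/-- `β` commutes with ring homomorphisms. [cite: MochizukiGenEll2010, Thm 2.1 proof p.12] -/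
theorem map_beta (k : ℕ) (r : K) : f (beta k r) = beta k (f r) := by
  simp [beta, map_ofNat]

/-- `N` commutes with ring homomorphisms. [cite: MochizukiGenEll2010, Thm 2.1 proof p.12] -/
theorem map_Nval (k : ℕ) (z : K × K) : f (Nval k z) = Nval k (f z.1, f z.2) := by
  simp [Nval, map_alpha, map_ofNat]

/-- Roots of `R` map to roots of `R` (Galois stability of the critical locus). [cite: MochizukiGenEll2010, Thm 2.1 proof p.12] -/
theorem aeval_Rpoly_map (k : ℕ) (θ : K) : aeval (f θ) (Rpoly k) = f (aeval θ (Rpoly k)) := by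
  rw [aeval_Rpoly, aeval_Rpoly, map_sub, map_pow, map_pow, map_alpha, map_beta]

/-- `Q_{f θ} = f(Q_θ)`: the critical points are permuted by field homomorphisms. [cite: MochizukiGenEll2010, Thm 2.1 proof p.12] -/
theorem map_critX (k : ℕ) (θ : K) : f (critX k θ) = critX k (f θ) := by
  simp [critX, critS, map_alpha, map_beta, map_div₀, map_ofNat]

end Map

end Field

end DeCrit

end Literature.NumberTheory.DiophantineGeometry.GenEll

end
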